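import Summits.NavierStokesRegularity.NavierStokesRegularity.Theorems.EpisodeBaseT.Negative.TwoSidedRingFamilyAnchorLaw
import Summits.NavierStokesRegularity.FluidComputer.PalasekTowerSterileCarrierAt
import HarnessLib

/-!
# At the thinness of record the strict anchor of «blob + μ₁ ring above + μ₂ mirror ring below» holds IFF `|μ₂| < |μ₁|`
# (Negative lane, `EpisodeBaseT`, line «doormirror», stub D2a — the complete two-sided classification)

Cell `ns-blowup`, seat `ns-blowup-refuter4` (g12; D-0074 GROUP C «BRIDGE SUPPORT», Negative lane (α)). Seventh file of the
mirror series (p567521, p569185, p572223, p572865, p578128, p579200).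

p579200 proved the two-sided law `∫ anchorIntegrand (μ₁ • P_δ + μ₂ • P♭_δ) c = (μ₁² − μ₂²) · I(δ, c)` and the sign-free cone
theorem. fc-prover-2's `ringThin_spec` (p565496, `PalasekTowerSterileCarrierAt`) supplies the SIGN at the thinness of record:
`I(ringThin, c) > 0` for `c > 0` (`integral_anchorIntegrand_ringThin_pos`, via p578128's quadratic law to drop the amplitude).
Hence the complete classification at `δ = ringThin`:

* `strictAnchor_ringFamilyThin_iff` — for an even admissible core `U₁` (`tsupport U₁ ⊆ B(0, 9/2)`, `U₁ 0 = c e₃`, `c > 0`)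
  that is FLAT at the origin (`⟪U₁ 0, ΔU₁ 0⟫ = 0`): `U₁ + (μ₁ • P + μ₂ • P♭)` strictly anchors at `0` **iff `μ₂² < μ₁²`**,
  for every viscosity `ν`;
* `sq_lt_sq_of_strictAnchor_ringFamilyThin` — without flatness but with `−ν⟪U₁ 0, ΔU₁ 0⟫ ≥ 0`: anchoring ⇒ `μ₂² < μ₁²`;
* `strictAnchor_tinyProfileAt_ringFamilyThin_iff` — on the BLOB OF RECORD `tinyProfileAt R a` (`0 < a ≤ 2`): the strict anchor at
  the ceiling point `0` holds iff `|μ₂| < |μ₁|`; `abs_lt_abs_of_levelZeroDataAt_ringFamilyThin` — every level-0 member of the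
  family has `|μ₂| < |μ₁|`: THE RING ABOVE MUST OUT-WEIGH ITS MIRROR BELOW, WHATEVER THE SIGNS.

This subsumes, at `δ = ringThin`, p569185 (`μ₁ = 0`), p572223 (`μ₁ = μ₂`), p578128 (`μ₁ = −μ₂`, sign-blindness) and
p572865 (swap `μ₁ ↔ μ₂`), and is consistent with p565496's positive member (`μ₂ = 0`, `μ₁ = μ > 0` small).

LABEL: kernel analysis (theorems only). WHAT THIS IS NOT: not Navier–Stokes evidence; not a refutation of D2a (existential,
and a theorem by name since p569312) or of any route item — the `iff` concerns the `anchor` clause AT THE POINT `0` only, not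
the whole `LevelZeroDataAt` record; no flow, stage, schedule or certificate; sorry-free, std axioms.
bears_on: LADDER-NS N1 (route-NavierStokesRegularity-PalasekTowerBreakdown), item 20303, stub D2a.

References: A. J. Majda, A. L. Bertozzi (CUP 2002) §1.8 Prop. 1.16 [cite: MajdaBertozziCUP2002, §1.8 Prop. 1.16].
-/

noncomputable section

open Literature.Analysis.FluidPDE
open Summit.NavierStokesRegularity.FluidComputer.PalasekTowerClayBridge
open Summit.NavierStokesRegularity.FluidComputer.PalasekTowerClayBridge.TinyBlob
open Summit.NavierStokesRegularity.FluidComputer.PalasekTowerClayBridge.Germ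
open Summit.NavierStokesRegularity.EpisodeBaseTRingPusherMirrorAnchorSign
open Summit.NavierStokesRegularity.EpisodeBaseTMirrorOddPusherNoAnchor
open Summit.NavierStokesRegularity.EpisodeBaseTTwoSidedRingFamilyAnchorLaw
open MeasureTheory InnerProductSpace Metric Set
open scoped RealInnerProductSpace ContDiff Laplacian

-- nested operator types `ℝ³ →L[ℝ] ℝ³ →L[ℝ] ℝ`
set_option maxSynthPendingDepth 3

namespace Summit.NavierStokesRegularity.EpisodeBaseTRingFamilyThinAnchorIff

/-- **The anchor number of the ring of record is POSITIVE**: `0 < ∫ anchorIntegrand (ringPusher ringThin) c` for `c > 0`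
(fc-prover-2's `ringThin_spec` at amplitude `1`). [cite: MajdaBertozziCUP2002, §1.8 Prop. 1.16] -/
theorem integral_anchorIntegrand_ringThin_pos {c : ℝ} (hc : 0 < c) :
    0 < ∫ x, anchorIntegrand (ringPusher ringThin) c x := by
  have h := ringThin_spec.2.2 1 c one_ne_zero hc
  rw [one_smul] at h
  exact h

/-- **THE COMPLETE TWO-SIDED CLASSIFICATION AT THE THINNESS OF RECORD.** `U₁ ∈ C_c^∞` divergence free, even about `0`,
`tsupport U₁ ⊆ B(0, 9/2)`, `U₁ 0 = c e₃` with `c > 0`, FLAT at the origin (`⟪U₁ 0, ΔU₁ 0⟫ = 0`). Then for every `ν μ₁ μ₂`: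
`U₁ + (μ₁ • ringPusher ringThin + μ₂ • mirrorRingPusher ringThin)` strictly anchors at `0` iff `μ₂² < μ₁²`.
[cite: MajdaBertozziCUP2002, §1.8 Prop. 1.16] -/
theorem strictAnchor_ringFamilyThin_iff {ν : ℝ} {U₁ : EuclideanSpace ℝ (Fin 3) → EuclideanSpace ℝ (Fin 3)}
    (h₁ : ContDiff ℝ ∞ U₁) (h₁c : HasCompactSupport U₁) (hdiv₁ : VectorCalculus.IsDivFree U₁) (he : IsEvenAbout 0 U₁)
    (hsupp : tsupport U₁ ⊆ ball (0 : EuclideanSpace ℝ (Fin 3)) (9 / 2)) {c : ℝ} (hc : 0 < c) (hU0 : U₁ 0 = c • e₃)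
    (hflat : ⟪U₁ 0, (Δ U₁) 0⟫ = 0) (μ₁ μ₂ : ℝ) :
    0 < ⟪(U₁ + (μ₁ • ringPusher ringThin + μ₂ • mirrorRingPusher ringThin)) 0,
        accel ν (U₁ + (μ₁ • ringPusher ringThin + μ₂ • mirrorRingPusher ringThin)) 0⟫ ↔ μ₂ ^ 2 < μ₁ ^ 2 := by
  rw [strictAnchor_ringFamily_iff h₁ h₁c hdiv₁ he hsupp hU0 ringThin_spec.1 ringThin_spec.2.1 μ₁ μ₂, hflat, mul_zero,
    neg_zero, mul_pos_iff_of_pos_right (integral_anchorIntegrand_ringThin_pos hc), sub_pos]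

/-- Without flatness (but with `−ν⟪U₁ 0, ΔU₁ 0⟫ ≥ 0`): an anchoring member has `μ₂² < μ₁²`. [cite: MajdaBertozziCUP2002, §1.8 Prop. 1.16] -/
theorem sq_lt_sq_of_strictAnchor_ringFamilyThin {ν : ℝ} {U₁ : EuclideanSpace ℝ (Fin 3) → EuclideanSpace ℝ (Fin 3)}
    (h₁ : ContDiff ℝ ∞ U₁) (h₁c : HasCompactSupport U₁) (hdiv₁ : VectorCalculus.IsDivFree U₁) (he : IsEvenAbout 0 U₁)
    (hsupp : tsupport U₁ ⊆ ball (0 : EuclideanSpace ℝ (Fin 3)) (9 / 2)) {c : ℝ} (hc : 0 < c) (hU0 : U₁ 0 = c • e₃)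
    (hΔ : 0 ≤ -(ν * ⟪U₁ 0, (Δ U₁) 0⟫)) {μ₁ μ₂ : ℝ}
    (h : 0 < ⟪(U₁ + (μ₁ • ringPusher ringThin + μ₂ • mirrorRingPusher ringThin)) 0,
        accel ν (U₁ + (μ₁ • ringPusher ringThin + μ₂ • mirrorRingPusher ringThin)) 0⟫) : μ₂ ^ 2 < μ₁ ^ 2 := by
  have k := (strictAnchor_ringFamily_iff h₁ h₁c hdiv₁ he hsupp hU0 ringThin_spec.1 ringThin_spec.2.1 μ₁ μ₂).1 h
  have hI := integral_anchorIntegrand_ringThin_pos hc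
  have hp : 0 < (μ₁ ^ 2 - μ₂ ^ 2) * ∫ x, anchorIntegrand (ringPusher ringThin) c x := by linarith
  rw [mul_pos_iff_of_pos_right hI, sub_pos] at hp
  exact hp

/-- **ON THE BLOB OF RECORD** (`0 < a ≤ 2`): the strict anchor of
`tinyProfileAt R a + (μ₁ • ringPusher ringThin + μ₂ • mirrorRingPusher ringThin)` at the ceiling point `0` holds iff
`|μ₂| < |μ₁|`, for every viscosity `ν`. [cite: MajdaBertozziCUP2002, §1.8 Prop. 1.16] -/
theorem strictAnchor_tinyProfileAt_ringFamilyThin_iff (R : TowerRates) {a : ℝ} (ha : 0 < a) (ha2 : a ≤ 2) (ν μ₁ μ₂ : ℝ) :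
    0 < ⟪(tinyProfileAt R a + (μ₁ • ringPusher ringThin + μ₂ • mirrorRingPusher ringThin)) 0,
        accel ν (tinyProfileAt R a + (μ₁ • ringPusher ringThin + μ₂ • mirrorRingPusher ringThin)) 0⟫ ↔ |μ₂| < |μ₁| := by
  obtain ⟨heven, -, hflat⟩ := tinyProfileAt_even_flat R a
  have hsupp : tsupport (tinyProfileAt R a) ⊆ ball (0 : EuclideanSpace ℝ (Fin 3)) (9 / 2) := fun x hx => by
    have h := tsupport_tinyProfileAt_subset (R := R) ha hx
    rw [mem_closedBall, dist_zero_right] at h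
    rw [mem_ball, dist_zero_right]
    linarith
  have hflat' : ⟪tinyProfileAt R a 0, (Δ (tinyProfileAt R a)) 0⟫ = 0 := by rw [hflat, inner_zero_right]
  rw [strictAnchor_ringFamilyThin_iff (ν := ν) (contDiff_tinyProfileAt R a) (hasCompactSupport_tinyProfileAt ha)
    (isDivFree_tinyProfileAt ha.ne') heven hsupp (R.Y_pos 0) (tinyProfileAt_zero R a).1 hflat' μ₁ μ₂, sq_lt_sq]

/-- **Every level-0 member of the two-sided family at the thinness of record has `|μ₂| < |μ₁|`** (blob of record,
`0 < a ≤ 2`, any radius `ρ`): the ring above out-weighs its mirror below. [cite: MajdaBertozziCUP2002, §1.8 Prop. 1.16] -/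
theorem abs_lt_abs_of_levelZeroDataAt_ringFamilyThin (R : TowerRates) {a : ℝ} (ha : 0 < a) (ha2 : a ≤ 2) {μ₁ μ₂ ρ : ℝ}
    (hL : LevelZeroDataAt R (tinyProfileAt R a + (μ₁ • ringPusher ringThin + μ₂ • mirrorRingPusher ringThin)) ρ) :
    |μ₂| < |μ₁| := by
  have hat : ‖(tinyProfileAt R a + (μ₁ • ringPusher ringThin + μ₂ • mirrorRingPusher ringThin)) 0‖ = R.Y 0 := by
    rw [Pi.add_apply, ringFamily_eq_zero_of_norm_lt ringThin_spec.1 ringThin_spec.2.1 μ₁ μ₂ (by rw [norm_zero]; norm_num),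
      add_zero]
    exact (tinyProfileAt_zero R a).2
  exact (strictAnchor_tinyProfileAt_ringFamilyThin_iff R ha ha2 1 μ₁ μ₂).1 (hL.anchor 0 hat)

/-- In particular the lower ring alone, the symmetric pair, the antisymmetric pair and any member with `|μ₁| ≤ |μ₂|` are NOT
level-0 data with the blob of record (`0 < a ≤ 2`, any `ρ`). [cite: MajdaBertozziCUP2002, §1.8 Prop. 1.16] -/
theorem not_levelZeroDataAt_ringFamilyThin_of_abs_le (R : TowerRates) {a : ℝ} (ha : 0 < a) (ha2 : a ≤ 2) {μ₁ μ₂ : ℝ}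
    (hle : |μ₁| ≤ |μ₂|) (ρ : ℝ) :
    ¬ LevelZeroDataAt R (tinyProfileAt R a + (μ₁ • ringPusher ringThin + μ₂ • mirrorRingPusher ringThin)) ρ := fun hL =>
  (not_lt.2 hle) (abs_lt_abs_of_levelZeroDataAt_ringFamilyThin R ha ha2 hL)

end Summit.NavierStokesRegularity.EpisodeBaseTRingFamilyThinAnchorIff

end
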